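import Summits.Ventures.QEC.Thresholds.HypergraphProductFamilyThresholds
import Summits.Ventures.QEC.Census.HGP.Gal4
import HarnessLib

/-!
# The `(3,4)`-regular GALLAGER class of hypergraph-product codes (census cell B.1, set `B1gal`):
# certified thresholds `p₀(6) ≈ .0070` (code capacity), `1/6` (erasure), `p₀(8) ≈ .0039` (phenomenological),
# both sectors, and the finite-size bound for the census row `[[100, 20, 4]]`

Venture QEC, `Summits/Ventures/QEC/Thresholds/` (LADDER-QEC rung Q5, cell Q5.hgp; qec-type-09 gen 3, item 09.HGPTH).
(Not to be confused with qec-lit-2's `GallagerHGPThresholds.lean`: the EXISTENTIAL positive-rate Tillich–Zémor Thm 1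
family `HGP(G_j, G_jᵀ)` from Gallager's random-coding theorem, check weight `12`, `p₀(11)`; here: the EXPLICIT census
class of `(3,4)`-bounded seed pairs, check weight `7`, `p₀(6)`, and the census rows' finite-size bounds.)
Instances of `HypergraphProductFamilyThresholds.lean` at seed degrees `(Δ_q, Δ_c) = (3, 4)` — every bit of a seed in
`≤ 3` checks, every check on `≤ 4` bits: the registered Gallager class of CENSUS-PREREG B.1 (15 representatives of the
`(3,4)`-regular classes with `≤ 12` columns, census/search-4/GALLAGER34.md) and every other `(3,4)`-bounded pair.
Both sectors of `HGP(H₁,H₂)` then have checks of weight `≤ 7` (`hgp_card_rowSupp_HX_le` / `_HZ_le`), so the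
Dumer–Kovalev–Pryadko constants are those of `w = 7`:

| noise model (per sector, minimum-weight decoding) | certified lower bound | theorems |
|---|---|---|
| code capacity (independent flips) | `p₀(6) = (1-√(35/36))/2`, `.0069 < p₀(6) < .0070` | `gallager34_z|x_isThresholdLowerBound`, `thresholdValue_six_bounds` |
| erasure (known locations) | `1/6` | `gallager34_z|x_erasure_isThresholdLowerBound` |
| phenomenological, `q = p`, poly. many rounds | `p₀(8) = (1-√(63/64))/2`, `.0039 < p₀(8) < .0040` | `gallager34_z|x_phenom_isThresholdLowerBound`, `thresholdValue_eight_bounds` |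

and, FINITE SIZE, the census row `HGP_gal34_n8_c0007_x_gal34_n8_c0007 = [[100, 20, 4]]` (type-04's kernel theorem
`Census.HGP.isCode_HGP_gal34_n8_c0007_x_gal34_n8_c0007`, `Census/HGP/Gal4.lean`; seed degrees checked by `decide`):
`P_fail ≤ 100·(12 s)⁴ / (6 (1 - 12 s))`, `s = √(p(1-p))`, for every minimum-weight decoder (`HGP_gal34_n8_c0007_zFailureProb_le`).

HONEST FRAMING: the family theorems are UNCONDITIONAL for every family of `(3,4)`-bounded seed pairs satisfying the
growth hypothesis `(n₁n₂ + m₁m₂)·r^{d i} → 0` (seed distances `d i → ∞` faster than `log` of the size); that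
hypothesis is NOT discharged here for an explicit infinite Gallager family (the census holds finitely many seeds, for
which the finite-size theorem is the operative certified statement). Kernel axioms, no named fact, no `native_decide`;
per-sector statements under independent `X`/`Z` noise; nothing about BP-OSD performance or Monte Carlo crossings.

## References

* [Gallager1963] R. G. Gallager, Low-Density Parity-Check Codes, MIT Press 1963, §2.1 ((j,k)-regular matrices).
* [DumerKovalevPryadko2015] I. Dumer, A. A. Kovalev, L. P. Pryadko, PRL 115 (2015) 050502, Thms 2–3, p. 5.
* [TillichZemor2014] J.-P. Tillich, G. Zémor, IEEE Trans. IT 60 (2014) 1193, §4, Thm 9.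
* [DennisEtAl2002] E. Dennis, A. Kitaev, A. Landahl, J. Preskill, J. Math. Phys. 43 (2002) 4452, §5.3 (p₀(ν)).
-/

noncomputable section

namespace Summit.Ventures.QEC.Thresholds

open Filter Topology Finset Matrix
open Literature.InformationTheory.QuantumCodes
open Literature.InformationTheory.Coding (minDist)

section Family

variable {m₁ n₁ m₂ n₂ : ℕ → ℕ}


/-! ### The `(3,4)`-regular Gallager class: `w = 7` in both sectors -/

/-- `p₀(6)`: decimal enclosure `.0069 < p₀(6) = (1-√(35/36))/2 < .0070` (check weight `7`, code capacity).
[cite: DennisEtAl2002, §5.3 eq. (p_c_2d) (the function p₀(ν), here ν = 6)] -/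
theorem thresholdValue_six_bounds : (0.0069 : ℝ) < thresholdValue 6 ∧ thresholdValue 6 < 0.0070 := by
  unfold thresholdValue
  have hx : (1 - 1 / (6 : ℝ) ^ 2) = 35 / 36 := by norm_num
  rw [hx]
  constructor
  · have : Real.sqrt (35 / 36) < 0.9862 := by
      rw [Real.sqrt_lt' (by norm_num)]
      norm_num
    linarith
  · have : (0.986 : ℝ) < Real.sqrt (35 / 36) := by
      rw [Real.lt_sqrt (by norm_num)]
      norm_num
    linarith

/-- `p₀(8)`: decimal enclosure `.0039 < p₀(8) = (1-√(63/64))/2 < .0040` (check weight `7`, phenomenological).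
[cite: DennisEtAl2002, §5.3 eq. (p_c_2d) (the function p₀(ν), here ν = 8)] -/
theorem thresholdValue_eight_bounds : (0.0039 : ℝ) < thresholdValue 8 ∧ thresholdValue 8 < 0.0040 := by
  unfold thresholdValue
  have hx : (1 - 1 / (8 : ℝ) ^ 2) = 63 / 64 := by norm_num
  rw [hx]
  constructor
  · have : Real.sqrt (63 / 64) < 0.9922 := by
      rw [Real.sqrt_lt' (by norm_num)]
      norm_num
    linarith
  · have : (0.992 : ℝ) < Real.sqrt (63 / 64) := by
      rw [Real.lt_sqrt (by norm_num)]
      norm_num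
    linarith

/-- **Code-capacity threshold `≥ p₀(6) ≈ .0070`, `Z`-sector, for every family of hypergraph products of
`(3,4)`-bounded seeds** (each bit in `≤ 3` checks, each check on `≤ 4` bits — the registered Gallager class of
census cell B.1): `X`-checks of weight `≤ 4 + 3 = 7`, seed distances `d i ≤ d(ker H₁ i)`, `d i ≤ d(ker (H₂ i)ᵀ)`,
`(n₁n₂ + m₁m₂)·r^{d i} → 0`, ANY minimum-weight decoders. UNCONDITIONAL.
[cite: DumerKovalevPryadko2015, Thm 2 (y = 0, w = 7)] [cite: Gallager1963, §2.1] -/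
theorem gallager34_z_isThresholdLowerBound (H₁ : ∀ i, Matrix (Fin (m₁ i)) (Fin (n₁ i)) (ZMod 2))
    (H₂ : ∀ i, Matrix (Fin (m₂ i)) (Fin (n₂ i)) (ZMod 2))
    (hB₁ : ∀ i, IsDegreeBounded (H₁ i) 3 4) (hB₂ : ∀ i, IsDegreeBounded (H₂ i) 3 4)
    (D : ∀ i, Decoder ((Fin (m₁ i) × Fin (n₂ i)) → ZMod 2)
      (((Fin (n₁ i) × Fin (n₂ i)) ⊕ (Fin (m₁ i) × Fin (m₂ i))) → ZMod 2))
    (hD : ∀ i, (D i).IsMinWeight (HGP.code (H₁ i) (H₂ i)).zSyndrome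
      ((HGP.code (H₁ i) (H₂ i)).kerX : Set _) hammingNorm)
    (d : ℕ → ℕ) (hd1 : ∀ i, 1 ≤ d i)
    (hd₁ : ∀ i, (d i : ℕ∞) ≤ minDist (pcCode (H₁ i))) (hd₂ : ∀ i, (d i : ℕ∞) ≤ minDist (pcCode (H₂ i)ᵀ))
    (hgrowth : ∀ r : ℝ, 0 < r → r < 1 →
      Tendsto (fun i => ((n₁ i * n₂ i + m₁ i * m₂ i : ℕ) : ℝ) * r ^ d i) atTop (𝓝 0)) :
    IsThresholdLowerBound (zFailureFamily (fun i => HGP.code (H₁ i) (H₂ i)) D) (thresholdValue 6) := by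
  have h := hgp_z_isThresholdLowerBound H₁ H₂ D hD (c₁ := 4) (q₂ := 3) (by norm_num)
    (fun i => (hB₁ i).2) (fun i => (hB₂ i).1) d hd1 hd₁ hd₂ hgrowth
  norm_num at h
  exact h

/-- **Code-capacity threshold `≥ p₀(6)`, `X`-sector, `(3,4)`-bounded seeds** (`Z`-checks of weight `≤ 3 + 4`,
`d i ≤ d(ker (H₁ i)ᵀ)`, `d i ≤ d(ker H₂ i)`). UNCONDITIONAL. [cite: DumerKovalevPryadko2015, Thm 2 (y = 0, w = 7)] -/
theorem gallager34_x_isThresholdLowerBound (H₁ : ∀ i, Matrix (Fin (m₁ i)) (Fin (n₁ i)) (ZMod 2))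
    (H₂ : ∀ i, Matrix (Fin (m₂ i)) (Fin (n₂ i)) (ZMod 2))
    (hB₁ : ∀ i, IsDegreeBounded (H₁ i) 3 4) (hB₂ : ∀ i, IsDegreeBounded (H₂ i) 3 4)
    (D : ∀ i, Decoder ((Fin (n₁ i) × Fin (m₂ i)) → ZMod 2)
      (((Fin (n₁ i) × Fin (n₂ i)) ⊕ (Fin (m₁ i) × Fin (m₂ i))) → ZMod 2))
    (hD : ∀ i, (D i).IsMinWeight (HGP.code (H₁ i) (H₂ i)).xSyndrome
      ((HGP.code (H₁ i) (H₂ i)).kerZ : Set _) hammingNorm)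
    (d : ℕ → ℕ) (hd1 : ∀ i, 1 ≤ d i)
    (hd₁ : ∀ i, (d i : ℕ∞) ≤ minDist (pcCode (H₁ i)ᵀ)) (hd₂ : ∀ i, (d i : ℕ∞) ≤ minDist (pcCode (H₂ i)))
    (hgrowth : ∀ r : ℝ, 0 < r → r < 1 →
      Tendsto (fun i => ((n₁ i * n₂ i + m₁ i * m₂ i : ℕ) : ℝ) * r ^ d i) atTop (𝓝 0)) :
    IsThresholdLowerBound (xFailureFamily (fun i => HGP.code (H₁ i) (H₂ i)) D) (thresholdValue 6) := by
  have h := hgp_x_isThresholdLowerBound H₁ H₂ D hD (q₁ := 3) (c₂ := 4) (by norm_num)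
    (fun i => (hB₁ i).1) (fun i => (hB₂ i).2) d hd1 hd₁ hd₂ hgrowth
  norm_num at h
  exact h

/-- **`p_c > .0069`** (decimal, `Z`-sector) for every `(3,4)`-bounded HGP family as above.
[cite: DumerKovalevPryadko2015, Thm 2 (y = 0, w = 7)] -/
theorem gallager34_z_accuracyThreshold_gt (H₁ : ∀ i, Matrix (Fin (m₁ i)) (Fin (n₁ i)) (ZMod 2))
    (H₂ : ∀ i, Matrix (Fin (m₂ i)) (Fin (n₂ i)) (ZMod 2))
    (hB₁ : ∀ i, IsDegreeBounded (H₁ i) 3 4) (hB₂ : ∀ i, IsDegreeBounded (H₂ i) 3 4)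
    (D : ∀ i, Decoder ((Fin (m₁ i) × Fin (n₂ i)) → ZMod 2)
      (((Fin (n₁ i) × Fin (n₂ i)) ⊕ (Fin (m₁ i) × Fin (m₂ i))) → ZMod 2))
    (hD : ∀ i, (D i).IsMinWeight (HGP.code (H₁ i) (H₂ i)).zSyndrome
      ((HGP.code (H₁ i) (H₂ i)).kerX : Set _) hammingNorm)
    (d : ℕ → ℕ) (hd1 : ∀ i, 1 ≤ d i)
    (hd₁ : ∀ i, (d i : ℕ∞) ≤ minDist (pcCode (H₁ i))) (hd₂ : ∀ i, (d i : ℕ∞) ≤ minDist (pcCode (H₂ i)ᵀ))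
    (hgrowth : ∀ r : ℝ, 0 < r → r < 1 →
      Tendsto (fun i => ((n₁ i * n₂ i + m₁ i * m₂ i : ℕ) : ℝ) * r ^ d i) atTop (𝓝 0)) :
    (0.0069 : ℝ) < accuracyThreshold (zFailureFamily (fun i => HGP.code (H₁ i) (H₂ i)) D) :=
  lt_of_lt_of_le thresholdValue_six_bounds.1
    (le_accuracyThreshold (gallager34_z_isThresholdLowerBound H₁ H₂ hB₁ hB₂ D hD d hd1 hd₁ hd₂ hgrowth)
      ((thresholdValue_le_half 6).trans (by norm_num)))

/-- **Erasure threshold `≥ 1/6`, `Z`-sector, `(3,4)`-bounded seeds.** UNCONDITIONAL.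
[cite: DumerKovalevPryadko2015, Thm 2 (erasure part, w = 7)] -/
theorem gallager34_z_erasure_isThresholdLowerBound (H₁ : ∀ i, Matrix (Fin (m₁ i)) (Fin (n₁ i)) (ZMod 2))
    (H₂ : ∀ i, Matrix (Fin (m₂ i)) (Fin (n₂ i)) (ZMod 2))
    (hB₁ : ∀ i, IsDegreeBounded (H₁ i) 3 4) (hB₂ : ∀ i, IsDegreeBounded (H₂ i) 3 4)
    (d : ℕ → ℕ) (hd1 : ∀ i, 1 ≤ d i)
    (hd₁ : ∀ i, (d i : ℕ∞) ≤ minDist (pcCode (H₁ i))) (hd₂ : ∀ i, (d i : ℕ∞) ≤ minDist (pcCode (H₂ i)ᵀ))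
    (hgrowth : ∀ r : ℝ, 0 < r → r < 1 →
      Tendsto (fun i => ((n₁ i * n₂ i + m₁ i * m₂ i : ℕ) : ℝ) * r ^ d i) atTop (𝓝 0)) :
    IsThresholdLowerBound (zErasureFamily (fun i => HGP.code (H₁ i) (H₂ i))) (1 / 6) := by
  have h := hgp_z_erasure_isThresholdLowerBound H₁ H₂ (c₁ := 4) (q₂ := 3) (by norm_num)
    (fun i => (hB₁ i).2) (fun i => (hB₂ i).1) d hd1 hd₁ hd₂ hgrowth
  norm_num at h
  exact h

/-- **Erasure threshold `≥ 1/6`, `X`-sector, `(3,4)`-bounded seeds.** UNCONDITIONAL.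
[cite: DumerKovalevPryadko2015, Thm 2 (erasure part, w = 7)] -/
theorem gallager34_x_erasure_isThresholdLowerBound (H₁ : ∀ i, Matrix (Fin (m₁ i)) (Fin (n₁ i)) (ZMod 2))
    (H₂ : ∀ i, Matrix (Fin (m₂ i)) (Fin (n₂ i)) (ZMod 2))
    (hB₁ : ∀ i, IsDegreeBounded (H₁ i) 3 4) (hB₂ : ∀ i, IsDegreeBounded (H₂ i) 3 4)
    (d : ℕ → ℕ) (hd1 : ∀ i, 1 ≤ d i)
    (hd₁ : ∀ i, (d i : ℕ∞) ≤ minDist (pcCode (H₁ i)ᵀ)) (hd₂ : ∀ i, (d i : ℕ∞) ≤ minDist (pcCode (H₂ i)))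
    (hgrowth : ∀ r : ℝ, 0 < r → r < 1 →
      Tendsto (fun i => ((n₁ i * n₂ i + m₁ i * m₂ i : ℕ) : ℝ) * r ^ d i) atTop (𝓝 0)) :
    IsThresholdLowerBound (xErasureFamily (fun i => HGP.code (H₁ i) (H₂ i))) (1 / 6) := by
  have h := hgp_x_erasure_isThresholdLowerBound H₁ H₂ (q₁ := 3) (c₂ := 4) (by norm_num)
    (fun i => (hB₁ i).1) (fun i => (hB₂ i).2) d hd1 hd₁ hd₂ hgrowth
  norm_num at h
  exact h

/-- **Phenomenological threshold `≥ p₀(8) ≈ .0039`, `Z`-sector, `(3,4)`-bounded seeds** (`q = p`, space-time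
check weight `7 + 2`, growth `(n₁n₂ + m₁m₂ + m₁n₂)·T i·r^{d i} → 0`, ANY minimum-weight space-time decoders).
UNCONDITIONAL. [cite: DumerKovalevPryadko2015, Thm 3 with p. 5 (w → w + 2, w = 7)] -/
theorem gallager34_z_phenom_isThresholdLowerBound (H₁ : ∀ i, Matrix (Fin (m₁ i)) (Fin (n₁ i)) (ZMod 2))
    (H₂ : ∀ i, Matrix (Fin (m₂ i)) (Fin (n₂ i)) (ZMod 2))
    (hB₁ : ∀ i, IsDegreeBounded (H₁ i) 3 4) (hB₂ : ∀ i, IsDegreeBounded (H₂ i) 3 4) (T : ℕ → ℕ)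
    (D : ∀ i, CSSPhenom.STDecoder (Fin (m₁ i) × Fin (n₂ i))
      ((Fin (n₁ i) × Fin (n₂ i)) ⊕ (Fin (m₁ i) × Fin (m₂ i))) (T i))
    (hD : ∀ i, (D i).IsMinWeight (CSSPhenom.stSyn (HGP.code (H₁ i) (H₂ i)).HX (T i))
      (CSSPhenom.stCycles (HGP.code (H₁ i) (H₂ i)).HX (T i)) hammingNorm)
    (d : ℕ → ℕ) (hd1 : ∀ i, 1 ≤ d i)
    (hd₁ : ∀ i, (d i : ℕ∞) ≤ minDist (pcCode (H₁ i))) (hd₂ : ∀ i, (d i : ℕ∞) ≤ minDist (pcCode (H₂ i)ᵀ))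
    (hgrowth : ∀ r : ℝ, 0 < r → r < 1 →
      Tendsto (fun i => (((n₁ i * n₂ i + m₁ i * m₂ i + m₁ i * n₂ i) * T i : ℕ) : ℝ) * r ^ d i)
        atTop (𝓝 0)) :
    IsThresholdLowerBound (zPhenomFailureFamily (fun i => HGP.code (H₁ i) (H₂ i)) T D) (thresholdValue 8) := by
  have h := hgp_z_phenom_isThresholdLowerBound H₁ H₂ T D hD (c₁ := 4) (q₂ := 3)
    (fun i => (hB₁ i).2) (fun i => (hB₂ i).1) d hd1 hd₁ hd₂ hgrowth
  norm_num at h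
  exact h

/-- **Phenomenological threshold `≥ p₀(8)`, `X`-sector, `(3,4)`-bounded seeds** (`q = p`). UNCONDITIONAL.
[cite: DumerKovalevPryadko2015, Thm 3 with p. 5 (w → w + 2, w = 7)] -/
theorem gallager34_x_phenom_isThresholdLowerBound (H₁ : ∀ i, Matrix (Fin (m₁ i)) (Fin (n₁ i)) (ZMod 2))
    (H₂ : ∀ i, Matrix (Fin (m₂ i)) (Fin (n₂ i)) (ZMod 2))
    (hB₁ : ∀ i, IsDegreeBounded (H₁ i) 3 4) (hB₂ : ∀ i, IsDegreeBounded (H₂ i) 3 4) (T : ℕ → ℕ)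
    (D : ∀ i, CSSPhenom.STDecoder (Fin (n₁ i) × Fin (m₂ i))
      ((Fin (n₁ i) × Fin (n₂ i)) ⊕ (Fin (m₁ i) × Fin (m₂ i))) (T i))
    (hD : ∀ i, (D i).IsMinWeight (CSSPhenom.stSyn (HGP.code (H₁ i) (H₂ i)).HZ (T i))
      (CSSPhenom.stCycles (HGP.code (H₁ i) (H₂ i)).HZ (T i)) hammingNorm)
    (d : ℕ → ℕ) (hd1 : ∀ i, 1 ≤ d i)
    (hd₁ : ∀ i, (d i : ℕ∞) ≤ minDist (pcCode (H₁ i)ᵀ)) (hd₂ : ∀ i, (d i : ℕ∞) ≤ minDist (pcCode (H₂ i)))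
    (hgrowth : ∀ r : ℝ, 0 < r → r < 1 →
      Tendsto (fun i => (((n₁ i * n₂ i + m₁ i * m₂ i + n₁ i * m₂ i) * T i : ℕ) : ℝ) * r ^ d i)
        atTop (𝓝 0)) :
    IsThresholdLowerBound (xPhenomFailureFamily (fun i => HGP.code (H₁ i) (H₂ i)) T D) (thresholdValue 8) := by
  have h := hgp_x_phenom_isThresholdLowerBound H₁ H₂ T D hD (q₁ := 3) (c₂ := 4)
    (fun i => (hB₁ i).1) (fun i => (hB₂ i).2) d hd1 hd₁ hd₂ hgrowth
  norm_num at h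
  exact h

/-- **`p_c > .0039`** under phenomenological noise (decimal, `Z`-sector) for every `(3,4)`-bounded HGP family as
above. [cite: DumerKovalevPryadko2015, Thm 3 with p. 5 (w → w + 2, w = 7)] -/
theorem gallager34_z_phenom_accuracyThreshold_gt (H₁ : ∀ i, Matrix (Fin (m₁ i)) (Fin (n₁ i)) (ZMod 2))
    (H₂ : ∀ i, Matrix (Fin (m₂ i)) (Fin (n₂ i)) (ZMod 2))
    (hB₁ : ∀ i, IsDegreeBounded (H₁ i) 3 4) (hB₂ : ∀ i, IsDegreeBounded (H₂ i) 3 4) (T : ℕ → ℕ)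
    (D : ∀ i, CSSPhenom.STDecoder (Fin (m₁ i) × Fin (n₂ i))
      ((Fin (n₁ i) × Fin (n₂ i)) ⊕ (Fin (m₁ i) × Fin (m₂ i))) (T i))
    (hD : ∀ i, (D i).IsMinWeight (CSSPhenom.stSyn (HGP.code (H₁ i) (H₂ i)).HX (T i))
      (CSSPhenom.stCycles (HGP.code (H₁ i) (H₂ i)).HX (T i)) hammingNorm)
    (d : ℕ → ℕ) (hd1 : ∀ i, 1 ≤ d i)
    (hd₁ : ∀ i, (d i : ℕ∞) ≤ minDist (pcCode (H₁ i))) (hd₂ : ∀ i, (d i : ℕ∞) ≤ minDist (pcCode (H₂ i)ᵀ))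
    (hgrowth : ∀ r : ℝ, 0 < r → r < 1 →
      Tendsto (fun i => (((n₁ i * n₂ i + m₁ i * m₂ i + m₁ i * n₂ i) * T i : ℕ) : ℝ) * r ^ d i)
        atTop (𝓝 0)) :
    (0.0039 : ℝ) < accuracyThreshold (zPhenomFailureFamily (fun i => HGP.code (H₁ i) (H₂ i)) T D) :=
  lt_of_lt_of_le thresholdValue_eight_bounds.1
    (le_accuracyThreshold
      (gallager34_z_phenom_isThresholdLowerBound H₁ H₂ hB₁ hB₂ T D hD d hd1 hd₁ hd₂ hgrowth)
      ((thresholdValue_le_half 8).trans (by norm_num)))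

end Family

/-! ### A census row: `HGP_gal34_n8_c0007_x_gal34_n8_c0007 = [[100, 20, 4]]`, finite size -/

/-- The registered `(3,4)`-regular seed `gal34_n8_c0007` (`6 × 8`, rows `15, 51, 85, 170, 204, 240` as bit words;
the unique connected class with `8` columns) is `(3,4)`-bounded — checked in the kernel by `decide`.
[cite: Gallager1963, §2.1 ((3,4)-regular matrix)] -/
theorem gal34_n8_c0007_isDegreeBounded :
    IsDegreeBounded (Census.rowMatrix 8 [15, 51, 85, 170, 204, 240]) 3 4 := by
  unfold IsDegreeBounded hammingNorm
  constructor <;> decide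

open Classical in
/-- **Certified finite-size bound for the census row `HGP_gal34_n8_c0007_x_gal34_n8_c0007 = [[100, 20, 4]]`**
(type-04's kernel theorem `Census.HGP.isCode_HGP_gal34_n8_c0007_x_gal34_n8_c0007`; `X`-checks of weight `≤ 7`):
for EVERY minimum-weight decoder of the `X`-syndrome and every `0 ≤ p ≤ 1/2` with `12√(p(1-p)) < 1`, the `Z`-sector
logical failure probability is `≤ 100·(12 s)⁴ / (6 (1 - 12 s))`, `s = √(p(1-p))` (e.g. `p = 10⁻³`: `s ≈ .0316`,
bound `≈ 5.5·10⁻¹`; `p = 10⁻⁴`: `≈ 3.9·10⁻³`). CERTIFIED (kernel), no named fact.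
[cite: DumerKovalevPryadko2015, Thm 2 (y = 0) with eq. (upper-bound-Nm-CSS)] -/
theorem HGP_gal34_n8_c0007_zFailureProb_le
    {D : Decoder ((Fin 6 × Fin 8) → ZMod 2) (((Fin 8 × Fin 8) ⊕ (Fin 6 × Fin 6)) → ZMod 2)}
    (hD : D.IsMinWeight
      (HGP.code (Census.rowMatrix 8 [15, 51, 85, 170, 204, 240])
        (Census.rowMatrix 8 [15, 51, 85, 170, 204, 240])).zSyndrome
      ((HGP.code (Census.rowMatrix 8 [15, 51, 85, 170, 204, 240])
        (Census.rowMatrix 8 [15, 51, 85, 170, 204, 240])).kerX : Set _) hammingNorm)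
    {p : ℝ} (hp0 : 0 ≤ p) (hp : p ≤ 1 / 2) (hr : 12 * Real.sqrt (p * (1 - p)) < 1) :
    ∑ e ∈ univ.filter (fun e : ((Fin 8 × Fin 8) ⊕ (Fin 6 × Fin 6)) → ZMod 2 =>
        ¬ D.Corrects
          (HGP.code (Census.rowMatrix 8 [15, 51, 85, 170, 204, 240])
            (Census.rowMatrix 8 [15, 51, 85, 170, 204, 240])).zSyndrome
          ((HGP.code (Census.rowMatrix 8 [15, 51, 85, 170, 204, 240])
            (Census.rowMatrix 8 [15, 51, 85, 170, 204, 240])).rowSpZ : Set _) e),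
        bernoulliWeight p (supp e) ≤
      100 * (12 * Real.sqrt (p * (1 - p))) ^ 4 / (6 * (1 - 12 * Real.sqrt (p * (1 - p)))) := by
  have e6 : ((3 + 4 - 1 : ℕ) : ℝ) = 6 := by norm_num
  have e12 : (2 : ℝ) * 6 = 12 := by norm_num
  have h := hgp_zFailureProb_le_of_isCode _ _ (Δq := 3) (Δc := 4) (by norm_num) gal34_n8_c0007_isDegreeBounded
    gal34_n8_c0007_isDegreeBounded Census.HGP.isCode_HGP_gal34_n8_c0007_x_gal34_n8_c0007 hD hp0 hp
    (by rw [e6, e12]; exact hr)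
  rw [e6, e12] at h
  exact_mod_cast h

end Summit.Ventures.QEC.Thresholds
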